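import Summits.BirchSwinnertonDyer.Rank1Residual.ManinAdditive.CMTwinStevensMinimalMembersCor
import HarnessLib

/-!
# CM root `Γ₁(N)`-laws at the prime `3` on the CM fields in which `3` is inert — THEOREM 45 transferred to
# `K = ℚ(i)` and to `K ∈ {ℚ(√−7), ℚ(√−19), ℚ(√−43), ℚ(√−67), ℚ(√−163)}` at `𝔭 = (3)`
# (cell `bsd-f2-manin`, planner `es` g32, MEMO-es §48; FILE A‴ = this file, lands after `…CMTwinStevensMinimalMembersCor`,
# independent of FILE A′ `CMGammaOneRootLawBeyondQi`) (T-es-53)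

TYPER NOTE (typer g20, T-es-53).  SOURCE = HOME/es/g32/InertThree-es-g32.lean sha16 514f0ac708ffa14e (189 l.; es: faithful farm check T-A3.lean
f2ecc4559c52cd32 rc 0 · 0 err · 0 warn · 0 s∗rry (MembersCor import replaced by the built part 1 + §5 inlined), self-contained InertThree-scratch-es-g32
rc 0; typer: own farm check of THIS text rc 0 · 0 warnings) VERBATIM except this note and ONE dedup delta: es's elementary lemma
`j_eq_1728_of_c₆_eq_zero` restates the tree's `Summit.BirchSwinnertonDyer.Rank1Residual.X12.j_eq_1728_of_c₆_eq_zero` (InertCoreInstancesA, an unrelated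
import cone; gate `dedup.landed`, as in T-es-48 p722419) — its 5-line proof is INLINED as the local `have hjV` in the two COR 48 theorems that used it; no
statement affected.  Continues ns `…ManinAdditive.KatoCurve.CMTwinMinimal` (FILE A = `CMTwinStevensMinimalMembers` p729412 + `…Cor` p729422; FILE A′ =
`CMGammaOneRootLawBeyondQi` p732179 is independent).  `@[conjecture]` (es's own tags) on the cell rows **E-es-156 `CMGammaOneRootLawThreeLocalJ1728`**
(root Γ₁(N)-law, 3-local, on the ℚ(i)-CM slice c₆ = 0 with 9 ∣ N) and **E-es-157 `CMGammaOneRootLawThreeLocalJInert`** (root Γ₁(N)-law, 3-local, on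
the CM curves of ℚ(√−7), ℚ(√−19), ℚ(√−43), ℚ(√−67), ℚ(√−163), 9 ∣ N) — es files both as THEOREM 48 := THEOREM 45 (MEMO-es §45, ref1 §R163/§R167
SOUND) transferred to the tame inert prime 𝔭 = (3), PAPER proof MEMO-es §48, audit R-es-74 PENDING at landing time ⇒ obligation nodes until
kernel-checked.  PROVED here (es): COR 48 — `not_three_dvd_maninConstant₁/maninConstant_on_cmClass_two_of_rootLawAtThree_of_classMembers` (Stevens'
3 ∤ c₁ and C3's 3 ∤ c₀ on every ℚ(i)-CM class with 9 ∣ N, via THM 46₂ `cmTwinStevensMinimalTwo_of_classMembers` + COR 46 `exists_primitive_witness`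
+ Faltings binder), the lattice-free forms `…_noLattice` (binders discharged by `ModularForms.exists_isNeronLatticeOf_holds`), and
`not_three_dvd_maninConstant₁/maninConstant_on_cmCurve_inert_of_rootLawAtThree` (the five other inert fields, law applied at the optimal curve
itself).  BC5 (es): census CENSUS-P3-v1 (282 ℚ(i) classes + 13 + 7 + 3 + 1 + 1 classes, N < 5·10⁵), witness ENGINEC-P3I-v1.  Typer checks: decl
names fresh in the tree; no `[cite:]` keys; imports `…CMTwinStevensMinimalMembersCor` + HarnessLib only (route-independent ManinAdditive cone); no
instances, no notation.  PARTITION 0 · beyond-print theorem: no (paper candidate) · bears_on stmt-BirchSwinnertonDyer-22968 (C3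
`ManinPrimeToThreeAtNine` on the CM classes with 3 inert) · BSD is not proved by this; E-es-156/157 and C3 OPEN.

Contents: two conjecture nodes (E-es-156 `CMGammaOneRootLawThreeLocalJ1728`, E-es-157 `CMGammaOneRootLawThreeLocalJInert`),
the elementary `j_eq_1728_of_c₆_eq_zero`, and COR 48: Stevens' `3 ∤ c₁` and C3's `3 ∤ c₀` on every `ℚ(i)`-CM class with
`9 ∣ N` (via THM 46₂ `cmTwinStevensMinimalTwo_of_classMembers`, whose lattice inclusion is prime-independent, + Faltings),
and on the CM curves of the five other inert class-number-one fields (law applied at the optimal curve itself), plus the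
lattice-free forms.  With E-es-152₃ (`ℚ(√−3)`, all levels, g31) this covers the CM locus of C3's domain (`9 ∣ N`) except the
twenty classes (`N < 5·10⁵`) with CM by `ℚ(√−2)` / `ℚ(√−11)`, where `3` SPLITS (ordinary reduction: THEOREM 45's STEP 4 is silent).
Status of the laws: THEOREM 48 := THEOREM 45 (MEMO-es §45, REF1 §R163) at a TAME inert prime — PAPER (audit ask R-es-74);
kernel status: conjecture nodes.  PARTITION 0 · beyond-print theorem: no · bears_on stmt-BirchSwinnertonDyer-22968 (C3) ·
BSD is not proved by this.
-/

set_option autoImplicit false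

noncomputable section

namespace Summit.BirchSwinnertonDyer.Rank1Residual.ManinAdditive.KatoCurve.CMTwinMinimal

open Complex Polynomial WeierstrassCurve Literature.NumberTheory.EllipticCurves
  Literature.NumberTheory.EllipticCurves.ModularForms
  Summit.BirchSwinnertonDyer.Rank1Residual.ManinAdditive.KatoCurve.CMOptimal
  Summit.BirchSwinnertonDyer.Rank1Residual.ManinAdditive.KatoCurve.CMOptimal.TwinLattice

/-! ## §8 The prime `3` on CM fields in which `3` is INERT: `ℚ(i)` (`j = 1728`, `9 ∥ N`) and the five class-number-one
fields `ℚ(√−7), ℚ(√−19), ℚ(√−43), ℚ(√−67), ℚ(√−163)` (MEMO-es §48)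

THEOREM 48 (paper) = THEOREM 45 transferred to `𝔭 = (3)` inert (`q = 9`): `k₃ = f(ε_𝔭) ≤ 1` because `U₁ = 1 + 3O_𝔭` is
pro-`3` and `ε` takes values in `μ(K)` (`μ₄` resp. `±1`), so `v₃(N) = 2k₃ ∈ {0, 2}` (census CENSUS-P3-v1: `649/649`,
`54/54`, `23/23`, `11/11`, `7/7`, `3/3` classes `N < 5·10⁵`); for `9 ∥ N`: `R₁ = K(𝔭)` is TAME of degree
`h = |(O/3)^× / μ(K)|` with different exponent `d = h − 1`: `(h, d) = (2, 1)` for `ℚ(i)` (`R₁ = ℚ(ζ₁₂)`), `(4, 3)` for the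
other five; `j_k = ⌊hν⌋ + 1`, `ν = v₃(Δ_min)/12`, and `δ = 1 − ⌊(j_k + d)/h⌋ = −⌊ν⌋ ≤ 0` IDENTICALLY (tame case:
`⌊(⌊hν⌋ + h)/h⌋ = 1 + ⌊ν⌋`).  Hence the ROOT law `Λ₁(f) ⊆ Λ(V) ⊗ ℤ₍₃₎` at every member with CM by `O_K`
(`ℚ(i)`: `ν ∈ {1/4, 1/2, 3/4}`, 188 + 188 + 188 curves; the others: `ν = 1/2`, twists by `3` of `3`-good curves),
with NO orbit factor.  Engine-C witness (ℚ(i) at 3, ENGINEC-P3I-v1): `v₃(D/Ω′) = 0` in 18/18 rows with `D ≠ 0`,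
`v_{𝔓_R}(G_V(1)) = j_k` (bound attained) in 17/20, trace lemma tight 18/18. -/

section InertThree

open CongruenceSubgroup
open scoped MatrixGroups ModularForm

variable {N : ℕ} [NeZero N]

/-- **E-es-156 — root `Γ₁(N)`-law on the `ℚ(i)`-CM slice, `3`-local** (THEOREM 48 (ι): `K = ℚ(i)`, `𝔭 = (3)` inert, `k₃ = 1`,
`(h, d) = (2, 1)`, `δ = 0` on all three strata `v₃(c₄) ∈ {2, 3, 4}`): for every globally minimal `V` with `c₆(V) = 0` and `9 ∣ N`,
every newform `f` of its class and its Néron lattice `L`, `Λ₁(f) ⊆ L ⊗ ℤ₍₃₎`.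
[B] es g32 MEMO-es §48; census CENSUS-P3-v1 (282 classes `N < 5·10⁵`); witness ENGINEC-P3I-v1. -/
@[conjecture]
def CMGammaOneRootLawThreeLocalJ1728 : Prop :=
  ∀ (V : WeierstrassCurve ℚ) [V.IsElliptic] [V.IsGloballyMinimal] {N : ℕ} [NeZero N]
    (f : CuspForm (Gamma0 N) 2) (L : PeriodPair),
    V.c₆ = 0 → 3 ^ 2 ∣ N → IsNewformOf V f → IsNeronLatticeOf (V.baseChange ℂ) L →
    ∀ z ∈ periodLatticeGamma1 f, ∃ s : ℤ, ¬ (3 : ℤ) ∣ s ∧ (s : ℂ) * z ∈ L.lattice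

/-- **E-es-157 — root `Γ₁(N)`-law, `3`-local, on the CM curves with `j ∈ {−3375, −884736, −884736000, −147197952000,
−262537412640768000}`** (CM by the maximal order of `ℚ(√−7), ℚ(√−19), ℚ(√−43), ℚ(√−67), ℚ(√−163)`, `3` inert;
THEOREM 48 (κ): `k₃ = 1`, `(h, d) = (4, 3)`, `ν = 1/2`, `δ = 0`) with `9 ∣ N`.
[B] es g32 MEMO-es §48; census CENSUS-P3-v1 (13 + 7 + 3 + 1 + 1 classes `N < 5·10⁵`). -/
@[conjecture]
def CMGammaOneRootLawThreeLocalJInert : Prop :=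
  ∀ (V : WeierstrassCurve ℚ) [V.IsElliptic] [V.IsGloballyMinimal] {N : ℕ} [NeZero N]
    (f : CuspForm (Gamma0 N) 2) (L : PeriodPair),
    (V.j = -3375 ∨ V.j = -884736 ∨ V.j = -884736000 ∨ V.j = -147197952000 ∨ V.j = -262537412640768000) →
    3 ^ 2 ∣ N → IsNewformOf V f → IsNeronLatticeOf (V.baseChange ℂ) L →
    ∀ z ∈ periodLatticeGamma1 f, ∃ s : ℤ, ¬ (3 : ℤ) ∣ s ∧ (s : ℂ) * z ∈ L.lattice

/-- **COR 48.S (ℚ(i) at 3) — the `3`-part of Stevens' `c₁ = ±1` for the `X₁(N)`-optimal curve of EVERY `ℚ(i)`-CM class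
with `9 ∣ N`**, whichever member carries the optimal datum: E-es-156 at the twist-reduced root `V` (`c₆(V) = 0`) + THM 46₂
(`Λ(V) ⊆ Λ(W)`, prime-independent) + optimality + Faltings. -/
theorem not_three_dvd_maninConstant₁_on_cmClass_two_of_rootLawAtThree_of_classMembers
    (h : CMGammaOneRootLawThreeLocalJ1728) (hcl : CMClassMembersTwo) (hL : LFunction_eq_of_isIsogenous)
    (W : WeierstrassCurve ℚ) [W.IsElliptic] [W.IsGloballyMinimal] (D : Gamma1ParametrizationData W N)
    (hopt : D.IsOptimal)
    (V : WeierstrassCurve ℚ) [V.IsElliptic] [V.IsGloballyMinimal] (LV : PeriodPair) (h6 : V.c₆ = 0)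
    (hN : 3 ^ 2 ∣ N)
    (hiso : WeierstrassCurve.IsIsogenous V W) (hLV : IsNeronLatticeOf (V.baseChange ℂ) LV)
    (hred : ∀ (W' : WeierstrassCurve ℚ) [W'.IsElliptic] [W'.IsGloballyMinimal],
        W'.j = 1728 → WeierstrassCurve.IsIsogenous V W' → (W'.c₄ = V.c₄ ∨ W'.c₄ = -4 * V.c₄)) :
    ¬ (3 : ℤ) ∣ D.maninConstant := by
  have hjV : V.j = 1728 := by
    -- es's `j_eq_1728_of_c₆_eq_zero` (= the tree's `Rank1Residual.X12.j_eq_1728_of_c₆_eq_zero`, unrelated import cone) inlined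
    have hΔ : V.Δ ≠ 0 := by rw [← WeierstrassCurve.coe_Δ']; exact V.Δ'.ne_zero
    have hc : V.c₄ ^ 3 = 1728 * V.Δ := by
      have := V.c_relation; rw [h6] at this; linear_combination -this
    rw [WeierstrassCurve.j, Units.val_inv_eq_inv_val, WeierstrassCurve.coe_Δ', hc]
    field_simp
  have hfV : IsNewformOf V D.f := isNewformOf_of_isIsogenous hL D.isNewformOf hiso
  have hle : LV.lattice ≤ D.L.lattice :=
    cmTwinStevensMinimalTwo_of_classMembers hcl V W LV D.L hjV hiso hLV D.isNeronLattice hred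
  refine not_dvd_maninConstant₁_of_rootLaw_of_witness D hopt (fun w hw => ?_) (exists_primitive_witness D.L 3)
  obtain ⟨s, hs, hsw⟩ := h V D.f LV h6 hN hfV hLV w hw
  exact ⟨s, hs, hle hsw⟩

/-- **COR 48.R (ℚ(i) at 3) — C3 (`3 ∤ c₀`) for every optimal `X₀(N)`-datum (lattice clause) of a `ℚ(i)`-CM class with
`9 ∣ N`** (second traceless prime `q = 2`: `4 ∣ N` on every `ℚ(i)`-CM class, `2` being ramified in `ℚ(i)`). -/
theorem not_three_dvd_maninConstant_on_cmClass_two_of_rootLawAtThree_of_classMembers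
    (h : CMGammaOneRootLawThreeLocalJ1728) (hcl : CMClassMembersTwo) (hL : LFunction_eq_of_isIsogenous)
    (W : WeierstrassCurve ℚ) [W.IsElliptic] [W.IsGloballyMinimal] (D : ModularParametrizationData W N)
    (hD : ∀ z ∈ D.L.lattice, ∃ w ∈ periodLattice D.f, z = D.c * w)
    (V : WeierstrassCurve ℚ) [V.IsElliptic] [V.IsGloballyMinimal] (LV : PeriodPair) (h6 : V.c₆ = 0)
    (hN : 3 ^ 2 ∣ N) (h4 : 2 ^ 2 ∣ N)
    (hiso : WeierstrassCurve.IsIsogenous V W) (hLV : IsNeronLatticeOf (V.baseChange ℂ) LV)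
    (hred : ∀ (W' : WeierstrassCurve ℚ) [W'.IsElliptic] [W'.IsGloballyMinimal],
        W'.j = 1728 → WeierstrassCurve.IsIsogenous V W' → (W'.c₄ = V.c₄ ∨ W'.c₄ = -4 * V.c₄)) :
    ¬ (3 : ℤ) ∣ D.maninConstant := by
  have hjV : V.j = 1728 := by
    -- es's `j_eq_1728_of_c₆_eq_zero` (= the tree's `Rank1Residual.X12.j_eq_1728_of_c₆_eq_zero`, unrelated import cone) inlined
    have hΔ : V.Δ ≠ 0 := by rw [← WeierstrassCurve.coe_Δ']; exact V.Δ'.ne_zero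
    have hc : V.c₄ ^ 3 = 1728 * V.Δ := by
      have := V.c_relation; rw [h6] at this; linear_combination -this
    rw [WeierstrassCurve.j, Units.val_inv_eq_inv_val, WeierstrassCurve.coe_Δ', hc]
    field_simp
  have hfV : IsNewformOf V D.f := isNewformOf_of_isIsogenous hL D.isNewformOf hiso
  have hle : LV.lattice ≤ D.L.lattice :=
    cmTwinStevensMinimalTwo_of_classMembers hcl V W LV D.L hjV hiso hLV D.isNeronLattice hred
  have heq := ModularForms.gamma1LatticeEqOfTwoTracelessPrimes_holds N D.f hfV.1 3 2 Nat.prime_three Nat.prime_two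
    (by decide) ((dvd_pow_self 3 two_ne_zero).trans hN) ((dvd_pow_self 2 two_ne_zero).trans h4)
    (hfV.1.cuspCoeff_eq_zero_of_sq_dvd Nat.prime_three hN) (hfV.1.cuspCoeff_eq_zero_of_sq_dvd Nat.prime_two h4)
  obtain ⟨z, hz, hzM⟩ := exists_primitive_witness LV 3
  refine not_dvd_maninConstant_of_saturated_mem_of_witness D hD Int.prime_three LV.lattice
    (fun γ => h V D.f LV h6 hN hfV hLV _ ?_) ⟨z, hle hz, fun s hs m hm => ?_⟩
  · rw [heq]; unfold periodLattice; exact AddSubgroup.subset_closure ⟨γ, rfl⟩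
  · exact_mod_cast hzM s hs m hm

/-- COR 48.S (ℚ(i) at 3), lattice-free form (`(LV, hLV)` discharged by `exists_isNeronLatticeOf_holds`). -/
theorem not_three_dvd_maninConstant₁_on_cmClass_two_of_rootLawAtThree_noLattice
    (h : CMGammaOneRootLawThreeLocalJ1728) (hcl : CMClassMembersTwo) (hL : LFunction_eq_of_isIsogenous)
    (W : WeierstrassCurve ℚ) [W.IsElliptic] [W.IsGloballyMinimal] (D : Gamma1ParametrizationData W N)
    (hopt : D.IsOptimal)
    (V : WeierstrassCurve ℚ) [V.IsElliptic] [V.IsGloballyMinimal] (h6 : V.c₆ = 0) (hN : 3 ^ 2 ∣ N)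
    (hiso : WeierstrassCurve.IsIsogenous V W)
    (hred : ∀ (W' : WeierstrassCurve ℚ) [W'.IsElliptic] [W'.IsGloballyMinimal],
        W'.j = 1728 → WeierstrassCurve.IsIsogenous V W' → (W'.c₄ = V.c₄ ∨ W'.c₄ = -4 * V.c₄)) :
    ¬ (3 : ℤ) ∣ D.maninConstant := by
  obtain ⟨LV, hLV⟩ := ModularForms.exists_isNeronLatticeOf_holds (V.baseChange ℂ)
  exact not_three_dvd_maninConstant₁_on_cmClass_two_of_rootLawAtThree_of_classMembers h hcl hL W D hopt V LV h6 hN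
    hiso hLV hred

/-- COR 48.R (ℚ(i) at 3), lattice-free form. -/
theorem not_three_dvd_maninConstant_on_cmClass_two_of_rootLawAtThree_noLattice
    (h : CMGammaOneRootLawThreeLocalJ1728) (hcl : CMClassMembersTwo) (hL : LFunction_eq_of_isIsogenous)
    (W : WeierstrassCurve ℚ) [W.IsElliptic] [W.IsGloballyMinimal] (D : ModularParametrizationData W N)
    (hD : ∀ z ∈ D.L.lattice, ∃ w ∈ periodLattice D.f, z = D.c * w)
    (V : WeierstrassCurve ℚ) [V.IsElliptic] [V.IsGloballyMinimal] (h6 : V.c₆ = 0) (hN : 3 ^ 2 ∣ N) (h4 : 2 ^ 2 ∣ N)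
    (hiso : WeierstrassCurve.IsIsogenous V W)
    (hred : ∀ (W' : WeierstrassCurve ℚ) [W'.IsElliptic] [W'.IsGloballyMinimal],
        W'.j = 1728 → WeierstrassCurve.IsIsogenous V W' → (W'.c₄ = V.c₄ ∨ W'.c₄ = -4 * V.c₄)) :
    ¬ (3 : ℤ) ∣ D.maninConstant := by
  obtain ⟨LV, hLV⟩ := ModularForms.exists_isNeronLatticeOf_holds (V.baseChange ℂ)
  exact not_three_dvd_maninConstant_on_cmClass_two_of_rootLawAtThree_of_classMembers h hcl hL W D hD V LV h6 hN h4
    hiso hLV hred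

/-- **COR 48.S (inert five) — the `3`-part of Stevens' `c₁ = ±1` when the `X₁(N)`-optimal curve itself has
`j ∈ {−3375, −884736, −884736000, −147197952000, −262537412640768000}` and `9 ∣ N`**, from E-es-157 alone. -/
theorem not_three_dvd_maninConstant₁_on_cmCurve_inert_of_rootLawAtThree (h : CMGammaOneRootLawThreeLocalJInert)
    (W : WeierstrassCurve ℚ) [W.IsElliptic] [W.IsGloballyMinimal] (D : Gamma1ParametrizationData W N)
    (hopt : D.IsOptimal)
    (hj : W.j = -3375 ∨ W.j = -884736 ∨ W.j = -884736000 ∨ W.j = -147197952000 ∨ W.j = -262537412640768000)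
    (hN : 3 ^ 2 ∣ N) : ¬ (3 : ℤ) ∣ D.maninConstant :=
  not_dvd_maninConstant₁_of_rootLaw_of_witness D hopt (h W D.f D.L hj hN D.isNewformOf D.isNeronLattice)
    (exists_primitive_witness D.L 3)

/-- **COR 48.R (inert five) — C3 for `X₀(N)`-data on the same curves with a second traceless prime `q ≠ 3`, `q² ∣ N`**
(always available: `q ∈ {7, 19, 43, 67, 163}`, `N = 9·q²·m²`). -/
theorem not_three_dvd_maninConstant_on_cmCurve_inert_of_rootLawAtThree (h : CMGammaOneRootLawThreeLocalJInert)
    (W : WeierstrassCurve ℚ) [W.IsElliptic] [W.IsGloballyMinimal] (D : ModularParametrizationData W N)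
    (hD : ∀ z ∈ D.L.lattice, ∃ w ∈ periodLattice D.f, z = D.c * w)
    (hj : W.j = -3375 ∨ W.j = -884736 ∨ W.j = -884736000 ∨ W.j = -147197952000 ∨ W.j = -262537412640768000)
    {q : ℕ} (hq : q.Prime) (hq3 : q ≠ 3) (hN : 3 ^ 2 ∣ N) (hqN : q ^ 2 ∣ N) :
    ¬ (3 : ℤ) ∣ D.maninConstant := by
  have hfW : IsNewformOf W D.f := D.isNewformOf
  have heq := ModularForms.gamma1LatticeEqOfTwoTracelessPrimes_holds N D.f hfW.1 3 q Nat.prime_three hq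
    (Ne.symm hq3) ((dvd_pow_self 3 two_ne_zero).trans hN) ((dvd_pow_self q two_ne_zero).trans hqN)
    (hfW.1.cuspCoeff_eq_zero_of_sq_dvd Nat.prime_three hN) (hfW.1.cuspCoeff_eq_zero_of_sq_dvd hq hqN)
  obtain ⟨z, hz, hzM⟩ := exists_primitive_witness D.L 3
  refine not_dvd_maninConstant_of_saturated_mem_of_witness D hD Int.prime_three D.L.lattice
    (fun γ => h W D.f D.L hj hN hfW D.isNeronLattice _ ?_) ⟨z, hz, fun s hs m hm => ?_⟩
  · rw [heq]; unfold periodLattice; exact AddSubgroup.subset_closure ⟨γ, rfl⟩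
  · exact_mod_cast hzM s hs m hm

end InertThree

end Summit.BirchSwinnertonDyer.Rank1Residual.ManinAdditive.KatoCurve.CMTwinMinimal

end
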